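import Literature.NumberTheory.LFunctions.PsiThetaSmallCheck
import HarnessLib

/-!
# `ψ − θ` below `2³²`: certified run, chunk 1 of 8 (plan N4′ of provefact `lagarias_iff`)

Topic: `Literature/NumberTheory/LFunctions`. Pure proof file (a kernel computation; nothing is
asserted). `run1` evaluates `PsiThetaSmall.runFrom table 1 67108864 20000` — the walk over the
perfect powers of `[1, 67108864)` with the big check `∏ ≤ exp(√n + (4/3)∛n)` at every change of
`∏_k ∏_{t ∈ T, t ≤ ⌊n^{1/k}⌋} t` (see `PsiThetaSmallCheck.lean`; its meaning is
`PsiThetaSmall.runFrom_sound` and `PsiThetaSmall.psi_sub_theta_le_of_cert`). The eight chunks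
(`(8192 i)² ≤ n < (8192 (i+1))²`) are assembled in `PsiThetaSmall.lean`. About one to two minutes of
kernel time (`decide +kernel`, standard axioms only; `maxHeartbeats 0` lifts the deterministic
time-out for this one declaration).

## References

* J.-L. Nicolas, *Small values of the Euler function and the Riemann hypothesis*, Acta Arith. 155
  (2012), Lemma 2.4 (2.12), proof, Case 1. [Nicolas2012]
-/

namespace Literature.NumberTheory.LFunctions.PsiThetaSmall

set_option maxHeartbeats 0 in
/-- **Chunk 1 of the certified run**: `1 ≤ n < 67108864`. [cite: Nicolas2012, Lemma 2.4, proof, Case 1] -/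
theorem run1 : runFrom table 1 67108864 20000 = true := by
  decide +kernel

end Literature.NumberTheory.LFunctions.PsiThetaSmall
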